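import Mathlib
import Literature.NumberTheory.DiophantineGeometry.GLHighestWeightExistsUniqueProofs
import Literature.NumberTheory.DiophantineGeometry.GLHighestWeightIsomorphismProofs
import Literature.NumberTheory.DiophantineGeometry.GLPolynomialRepSemisimpleProofs
import Summits.MatrixMultiplication.MatrixMultiplication.Theorems.GLnSeparatingDesignsSeparationDegreeCostLowerTranslates

/-!
# Stub `stub_finrank_irreducible_le` of line `SketchIdeator1` — irreducible constituents of
# `ℂ[x_{ij}]_{≤ s}` have dimension `≤ s^{n(n-1)/2}` (BCGPU 2024 Lemma 2.7 without Weyl's formula)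

Crux `stmt-MatrixMultiplication-18361` (`GLnSeparatingDesigns.SeparationDegreeCost`, BCGPU 2024
Cor. 2.8 with border clause), lead's stub (the per-block cap in the Wedderburn pricing
`Σᵢ dᵢ^ω ≤ d_max^{ω-2} Σᵢ dᵢ²`): for `n ≥ 3`, `s ≥ 2`, every irreducible subrepresentation `W` of the
polynomials `V = ℂ[x_{ij}]_{≤ s}` under right translation `R_g` by `GL_n(ℂ)` (tree `matTranslRep`)
satisfies `dim W ≤ s^{n(n-1)/2}`.

Proof (group version of "`V(λ) = U(𝔫⁻) v_λ`", Goodman–Wallach Lemma 3.2.2, with a degree count):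
* `W` (transported to a subrepresentation `U` of `ℂ[x]` itself) is a POLYNOMIAL representation —
  the coefficients of `R_g q` are polynomials in `g` (`exists_coeff_matTransl_eq_eval`, universal
  translate), hence so is every matrix coefficient of a representation embedded in `ℂ[x]`
  (`isPolynomialRep_of_embedding`);
* so it has a highest-weight vector `v` (tree `exists_hasHighestWeight_of_isRationalRep`), and by
  irreducibility and the density of the big cell `U = span(GL·v) = span(U⁻·v)` (tree
  `span_orbit_eq_lowerSpan`);
* torus weights of polynomials are column sums: every monomial of `v` has column sums `χ = ` the
  weight of `v` (`natCast_colsum_eq_of_mem_weightSpace`: `R_{diag t}` scales `x^m` by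
  `∏_b t_b^{Σ_a m(a,b)}`, `coeff_matTransl_diagonal`, and torus characters are independent, tree
  `eq_of_forall_weightChar_eq`), with `Σ χ ≤ deg v ≤ s`;
* the `U⁻`-translates of such a `v` span `≤ ∏_b C(χ_b + n-1-b, n-1-b) ≤ s^{n(n-1)/2}` dimensions
  (`finrank_span_lowerTranslates_le`, file `…LowerTranslates`).
References: Blasiak–Cohn–Grochow–Pratt–Umans 2024 (arXiv:2410.14905) Lemma 2.7; Goodman–Wallach,
GTM 255, Lemma 3.2.2; card `big-cell-block-bound` (Cruxes/SeparationDegreeCost/Ideas).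
-/

-- `Summit.MatrixMultiplication.MatrixMultiplication.…` is the tree's mandated summit-side namespace
-- (single-conjunct summit: Sub = Summit), which the `dupNamespace` linter would flag on every decl.
set_option linter.dupNamespace false

noncomputable section

open scoped BigOperators
open Literature.NumberTheory.DiophantineGeometry MvPolynomial Matrix

namespace Summit.MatrixMultiplication.MatrixMultiplication.Theorems

/-- Right translation does not increase the total degree: `deg (R_g P) ≤ deg P` (the substitution
`X_{ij} ↦ ∑ₗ g_{lj} X_{il}` is linear). -/
theorem totalDegree_matTransl_le {σ k : Type*} [Fintype σ] [CommRing k] [Nontrivial k]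
    (g : Matrix σ σ k) (P : MvPolynomial (σ × σ) k) :
    (matTransl σ k g P).totalDegree ≤ P.totalDegree := by
  classical
  have hL : ∀ ij : σ × σ, (∑ l, g l ij.2 • X (ij.1, l) : MvPolynomial (σ × σ) k).totalDegree ≤ 1 :=
    fun ij => totalDegree_finsetSum_le fun l _ =>
      (totalDegree_smul_le _ _).trans (totalDegree_X _).le
  unfold matTransl
  rw [aeval_eq_bind₁]
  conv_lhs => rw [P.as_sum]
  rw [map_sum]
  refine totalDegree_finsetSum_le fun m hm => ?_
  rw [bind₁_monomial]
  refine (totalDegree_mul _ _).trans ?_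
  rw [totalDegree_C, zero_add]
  refine (totalDegree_finsetProd _ _).trans ?_
  refine le_trans (Finset.sum_le_sum fun c _ => (totalDegree_pow _ _).trans
    (Nat.mul_le_mul_left (m c) (hL c))) ?_
  simp only [mul_one]
  exact le_totalDegree hm

variable {σ : Type*} [Fintype σ] [LinearOrder σ] {k : Type*} [Field k]

/-! ### Matrix coefficients of right translation are polynomial -/

omit [LinearOrder σ] in
/-- The coefficients of `R_g q` are polynomials in the entries of `g`: there is `P` with
`coeff_e (R_g q) = P(g)` for all `g` (the universal translate `x_{ij} ↦ Σ_l y_{lj} x_{il}` has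
polynomial coefficients, and `R_g` is its specialisation `y := g`). -/
theorem exists_coeff_matTransl_eq_eval (q : MvPolynomial (σ × σ) k) (e : σ × σ →₀ ℕ) :
    ∃ P : MvPolynomial (σ × σ) k, ∀ g : Matrix σ σ k,
      coeff e (matTransl σ k g q) = eval (fun ij => g ij.1 ij.2) P := by
  -- the universal translate, with parameters `y_{lj} = X (l, j)` in the coefficient ring
  let Φ : MvPolynomial (σ × σ) k →ₐ[k] MvPolynomial (σ × σ) (MvPolynomial (σ × σ) k) :=
    aeval fun ij : σ × σ => ∑ l, C (X (l, ij.2)) * X (ij.1, l)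
  refine ⟨coeff e (Φ q), fun g => ?_⟩
  have key : (MvPolynomial.map (eval fun ij : σ × σ => g ij.1 ij.2)).comp (Φ : _ →+* _) =
      (matTransl σ k g : MvPolynomial (σ × σ) k →+* MvPolynomial (σ × σ) k) := by
    refine MvPolynomial.ringHom_ext (fun c => ?_) (fun ij => ?_)
    · rw [RingHom.comp_apply, RingHom.coe_coe, RingHom.coe_coe, MvPolynomial.algHom_C,
        MvPolynomial.algHom_C, MvPolynomial.algebraMap_eq]
      change MvPolynomial.map _ (C (C c)) = C c
      rw [map_C, eval_C]
    · rw [RingHom.comp_apply, RingHom.coe_coe, RingHom.coe_coe, matTransl_X]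
      change MvPolynomial.map _ (aeval _ (X ij)) = _
      rw [aeval_X, map_sum, Finset.sum_congr rfl]
      intro l _
      rw [map_mul, map_C, eval_X, map_X, smul_eq_C_mul]
  have h := congrArg (fun f => coeff e (f q)) key
  simp only [RingHom.comp_apply, RingHom.coe_coe, coeff_map] at h
  exact h.symm

/-- **Representations embedded in `k[Mat_σ]` with right translation are polynomial**: if
`ι : M ↪ k[x_{ij}]` is an injective linear map intertwining `τ g` with `R_g`, then every matrix
coefficient `g ↦ φ (τ g m)` is a polynomial in the entries of `g`. -/
theorem isPolynomialRep_of_embedding {M : Type*} [AddCommGroup M] [Module k M]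
    (τ : Representation k (GL σ k) M) (ι : M →ₗ[k] MvPolynomial (σ × σ) k)
    (hι : Function.Injective ι) (hτ : ∀ (g : GL σ k) (m : M), ι (τ g m) = matTransl σ k g (ι m)) :
    IsPolynomialRep τ := by
  classical
  intro m φ
  -- extend `φ` along `ι`
  obtain ⟨r, hr⟩ := ι.exists_leftInverse_of_injective (LinearMap.ker_eq_bot.2 hι)
  set ψ : MvPolynomial (σ × σ) k →ₗ[k] k := φ ∘ₗ r with hψ
  have hφ : ∀ m' : M, φ m' = ψ (ι m') := fun m' => by
    rw [hψ, LinearMap.comp_apply, ← LinearMap.comp_apply r ι, hr, LinearMap.id_apply]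
  -- the exponents of degree `≤ d = deg (ι m)` (finitely many)
  set d := (ι m).totalDegree with hd
  have hDfin : ({e : σ × σ →₀ ℕ | (e.sum fun _ n => n) ≤ d} : Set _).Finite := by
    haveI : Module.Finite k (restrictSupport k {e : σ × σ →₀ ℕ | (e.sum fun _ n => n) ≤ d}) :=
      show Module.Finite k (restrictTotalDegree (σ × σ) k d) from inferInstance
    exact Set.finite_coe_iff.1 (Module.Finite.finite_basis (basisRestrictSupport k
      {e : σ × σ →₀ ℕ | (e.sum fun _ n => n) ≤ d}))
  set D : Finset (σ × σ →₀ ℕ) := hDfin.toFinset with hD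
  -- coefficient polynomials
  choose P hP using fun e : σ × σ →₀ ℕ => exists_coeff_matTransl_eq_eval (ι m) e
  refine ⟨∑ e ∈ D, ψ (monomial e 1) • P e, fun g => ?_⟩
  have hsupp : (matTransl σ k (g : Matrix σ σ k) (ι m)).support ⊆ D := by
    intro e he
    rw [hD, Set.Finite.mem_toFinset]
    exact (le_totalDegree he).trans (totalDegree_matTransl_le _ _)
  have hmon : ∀ (e : σ × σ →₀ ℕ) (c : k), (monomial e c : MvPolynomial (σ × σ) k) = c • monomial e 1 :=
    fun e c => by rw [smul_monomial, smul_eq_mul, mul_one]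
  rw [hφ, hτ, (matTransl σ k (g : Matrix σ σ k) (ι m)).as_sum,
    Finset.sum_subset hsupp (fun e _ he => by rw [notMem_support_iff.1 he, map_zero]),
    map_sum, map_sum]
  refine Finset.sum_congr rfl fun e _ => ?_
  rw [hmon e, map_smul, smul_eval, ← hP e, smul_eq_mul, mul_comm]

/-! ### Torus weights in `k[Mat_σ]` are column sums -/

omit [LinearOrder σ] in
/-- Right translation by a diagonal matrix scales monomials:
`coeff_m (R_{diag d} q) = (∏_{ij} d_j^{m_{ij}}) · coeff_m q`. -/
theorem coeff_matTransl_diagonal [DecidableEq σ] (d : σ → k) (q : MvPolynomial (σ × σ) k)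
    (m : σ × σ →₀ ℕ) :
    coeff m (matTransl σ k (diagonal d) q) = (∏ ij ∈ m.support, d ij.2 ^ m ij) * coeff m q := by
  classical
  have hX : ∀ ij : σ × σ, matTransl σ k (diagonal d) (X ij) = C (d ij.2) * X ij := fun ij => by
    rw [matTransl_X, Finset.sum_eq_single ij.2 (fun l _ hl => by rw [diagonal_apply_ne _ hl, zero_smul])
      (fun h => absurd (Finset.mem_univ _) h), diagonal_apply_eq, smul_eq_C_mul]
  have hmon : ∀ (m' : σ × σ →₀ ℕ) (a : k), matTransl σ k (diagonal d) (monomial m' a) =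
      C (∏ ij ∈ m'.support, d ij.2 ^ m' ij) * monomial m' a := fun m' a => by
    rw [monomial_eq, map_mul, MvPolynomial.algHom_C, MvPolynomial.algebraMap_eq, Finsupp.prod,
      map_prod (matTransl σ k (diagonal d)), map_prod C]
    simp only [map_pow, hX, mul_pow, Finset.prod_mul_distrib]
    ring
  induction q using MvPolynomial.induction_on' generalizing m with
  | monomial m' a =>
    rw [hmon, coeff_C_mul, coeff_monomial]
    by_cases h : m' = m
    · subst h; rfl
    · rw [if_neg h, mul_zero, mul_zero]
  | add p q hp hq => rw [map_add, coeff_add, coeff_add, hp, hq, mul_add]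

/-- **Torus weights of polynomials are column sums.** If `ι : M ↪ k[x_{ij}]` intertwines `τ` with
right translation and `v ∈ M` is a torus weight vector of weight `χ`, then every monomial `x^m`
of `ι v` has column sums `Σ_a m(a,b) = χ b` (the diagonal matrix `t` scales `x^m` by
`∏_b t_b^{Σ_a m(a,b)}` and `v` by `t^χ`; characters of the torus are linearly independent). -/
theorem natCast_colsum_eq_of_mem_weightSpace [Infinite k] {M : Type*} [AddCommGroup M] [Module k M]
    (τ : Representation k (GL σ k) M) (ι : M →ₗ[k] MvPolynomial (σ × σ) k)
    (hτ : ∀ (g : GL σ k) (m : M), ι (τ g m) = matTransl σ k g (ι m)) {χ : Weight σ} {v : M}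
    (hv : v ∈ weightSpace τ χ) {m : σ × σ →₀ ℕ} (hm : m ∈ (ι v).support) (b : σ) :
    ((∑ a, m (a, b) : ℕ) : ℤ) = χ b := by
  classical
  suffices h : (fun b => ((∑ a, m (a, b) : ℕ) : ℤ)) = χ from congrFun h b
  refine eq_of_forall_weightChar_eq (k := k) fun t ht => ?_
  let d : σ → k := fun i => (t : Matrix σ σ k) i i
  have htd : (t : Matrix σ σ k) = diagonal d :=
    Literature.Computability.AlgebraicComplexity.coe_eq_diagonal_of_isDiagonalGL ht
  -- compare the coefficients of `x^m` in `R_t (ι v) = t^χ • ι v`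
  have h1 : coeff m (ι (τ t v)) = weightChar χ t * coeff m (ι v) := by
    rw [hv t ht, map_smul, coeff_smul, smul_eq_mul]
  rw [hτ, htd, coeff_matTransl_diagonal] at h1
  have h2 : (∏ ij ∈ m.support, d ij.2 ^ m ij) = weightChar χ t :=
    mul_right_cancel₀ (mem_support_iff.1 hm) h1
  rw [← h2]
  -- `∏_b t_b^{Σ_a m(a,b)} = ∏_{(a,b) ∈ supp m} d_b^{m(a,b)}`
  unfold weightChar
  simp only [zpow_natCast]
  change ∏ i, d i ^ (∑ a, m (a, i)) = ∏ ij ∈ m.support, d ij.2 ^ m ij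
  simp only [← Finset.prod_pow_eq_pow_sum]
  rw [Finset.prod_comm, ← Fintype.prod_prod_type' (f := fun a b => d b ^ m (a, b))]
  exact (Finset.prod_subset (Finset.subset_univ _) fun ab _ hab => by
    rw [Prod.mk.eta, Finsupp.notMem_support_iff.1 hab, pow_zero]).symm

/-! ### The stub: irreducible constituents of `ℂ[x_{ij}]_{≤ s}` are small -/

omit [Fintype σ] in
/-- `u(A|_{low}) = u(c)` for the matrix `A = u(c)`: reading off the strictly lower entries of a lower
unitriangular matrix and rebuilding gives it back. -/
theorem lowerUnitriMatrix_entries_lowerUnitriMatrix (c : LowIdx σ → k) :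
    (lowerUnitriMatrix fun p : LowIdx σ => lowerUnitriMatrix c p.1.1 p.1.2) = lowerUnitriMatrix c := by
  ext i j
  rcases lt_trichotomy j i with h | rfl | h
  · rw [lowerUnitriMatrix_apply_of_lt _ h, lowerUnitriMatrix_apply_of_lt _ h]
  · rw [lowerUnitriMatrix_apply_self, lowerUnitriMatrix_apply_self]
  · rw [lowerUnitriMatrix_apply_of_gt _ h, lowerUnitriMatrix_apply_of_gt _ h]

/-- **Stub S3** of line `SketchIdeator1` (BCGPU 2024 Lemma 2.7 without the Weyl dimension formula):
for `n ≥ 3`, `s ≥ 2`, every irreducible subrepresentation `W` of the polynomials of degree `≤ s`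
under right translation by `GL_n(ℂ)` has `dim W ≤ s^{n(n-1)/2}`. Proof: `W` is a polynomial
representation (`isPolynomialRep_of_embedding`), so it has a highest-weight vector `v`
(`exists_hasHighestWeight_of_isRationalRep`) and `W = span(GL·v) = span(U⁻·v)`
(irreducibility, `span_orbit_eq_lowerSpan`); the monomials of `v` have column sums
`χ = ` the weight (`natCast_colsum_eq_of_mem_weightSpace`), `Σ χ ≤ deg v ≤ s`, and the
`U⁻`-translates of `v` span at most `∏_b C(χ_b + n-1-b, n-1-b) ≤ s^{n(n-1)/2}` dimensions
(`finrank_span_lowerTranslates_le`). -/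
theorem stub_finrank_irreducible_le {n s : ℕ} (hn : 3 ≤ n) (hs : 2 ≤ s)
    (V : Subrepresentation (matTranslRep (Fin n) ℂ))
    (hV : ∀ p, p ∈ V.toSubmodule ↔ p.totalDegree ≤ s)
    (W : Subrepresentation V.toRepresentation)
    (hW : IsSimpleOrder (Subrepresentation W.toRepresentation)) :
    Module.finrank ℂ W.toSubmodule ≤ s ^ (n * (n - 1) / 2) := by
  classical
  -- `V = ℂ[x]_{≤ s}` is finite-dimensional, hence so is `W`
  have hVeq : V.toSubmodule = restrictTotalDegree (Fin n × Fin n) ℂ s :=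
    Submodule.ext fun p => (hV p).trans (mem_restrictTotalDegree _ _ p).symm
  haveI : FiniteDimensional ℂ V.toSubmodule := by rw [hVeq]; infer_instance
  haveI : FiniteDimensional ℂ W.toSubmodule := FiniteDimensional.finiteDimensional_submodule _
  -- transport `W` to a subrepresentation `U` of `ℂ[x]` itself (one coercion level)
  let U : Subrepresentation (matTranslRep (Fin n) ℂ) :=
    ⟨W.toSubmodule.map V.toSubmodule.subtype, fun g => by
      rintro _ ⟨w, hw, rfl⟩
      exact ⟨V.toRepresentation g w, W.apply_mem_toSubmodule g hw, rfl⟩⟩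
  let eW : W.toSubmodule ≃ₗ[ℂ] U.toSubmodule :=
    Submodule.equivMapOfInjective _ V.toSubmodule.injective_subtype _
  have heW : ∀ (g : GL (Fin n) ℂ) (w : W.toSubmodule),
      eW (W.toRepresentation g w) = U.toRepresentation g (eW w) := fun g w => Subtype.ext rfl
  haveI : FiniteDimensional ℂ U.toSubmodule :=
    Submodule.finiteDimensional_of_le (S₂ := restrictTotalDegree (Fin n × Fin n) ℂ s)
      (by rw [← hVeq]; exact Submodule.map_subtype_le _ _)
  have hUs : ∀ u : U.toSubmodule, (u : MvPolynomial (Fin n × Fin n) ℂ).totalDegree ≤ s := by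
    rintro ⟨_, w, hw, rfl⟩
    exact (hV _).1 (Submodule.coe_mem w)
  -- `U` is a polynomial representation
  have hpol : IsPolynomialRep U.toRepresentation :=
    isPolynomialRep_of_embedding U.toRepresentation U.toSubmodule.subtype Subtype.val_injective
      (fun _ _ => rfl)
  -- `W ≠ 0`: the lattice of subrepresentations is nontrivial
  haveI : Nontrivial W.toSubmodule := by
    have hne : (⊥ : Subrepresentation W.toRepresentation) ≠ ⊤ := by
      haveI := hW.toNontrivial; exact bot_ne_top
    have hne' : (⊥ : Submodule ℂ W.toSubmodule) ≠ ⊤ := fun h =>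
      hne (Subrepresentation.toSubmodule_injective h)
    exact (Submodule.nontrivial_iff ℂ).1 (nontrivial_of_ne _ _ hne')
  haveI : Nontrivial U.toSubmodule := eW.injective.nontrivial
  -- a highest-weight vector `v` of `U`
  obtain ⟨χ, hχ⟩ := exists_hasHighestWeight_of_isRationalRep U.toRepresentation hpol.isRationalRep
  obtain ⟨v, hv0, hv⟩ := (hasHighestWeight_iff_exists _ χ).1 hχ
  -- irreducibility (transported from `W`): `U = span (GL · v) = span (U⁻ · v)`
  have htop : lowerSpan U.toRepresentation v = ⊤ := by
    rw [← span_orbit_eq_lowerSpan hpol.isRationalRep hv]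
    set O : Submodule ℂ U.toSubmodule :=
      Submodule.span ℂ (Set.range fun g : GL (Fin n) ℂ => U.toRepresentation g v) with hO
    -- pull the orbit span back to a subrepresentation of `W`
    let O' : Subrepresentation W.toRepresentation :=
      ⟨O.comap eW.toLinearMap, fun g w hw => by
        change eW (W.toRepresentation g w) ∈ O
        rw [heW]
        exact apply_mem_span_orbit U.toRepresentation v g hw⟩
    have hO' : O' ≠ ⊥ := fun h => by
      have hvO : eW.symm v ∈ O'.toSubmodule := by
        change eW (eW.symm v) ∈ O
        rw [LinearEquiv.apply_symm_apply]
        exact Submodule.subset_span ⟨1, by simp⟩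
      rw [h] at hvO
      exact hv0 (eW.symm.injective (((Submodule.mem_bot ℂ).1 hvO).trans (map_zero _).symm))
    have htop' : O'.toSubmodule = ⊤ :=
      congrArg Subrepresentation.toSubmodule ((hW.eq_bot_or_eq_top O').resolve_left hO')
    refine eq_top_iff.2 fun u _ => ?_
    have hu : eW.symm u ∈ O'.toSubmodule := by rw [htop']; trivial
    change eW (eW.symm u) ∈ O at hu
    rwa [LinearEquiv.apply_symm_apply] at hu
  -- column sums of the monomials of `v`
  have hv0' : (v : MvPolynomial (Fin n × Fin n) ℂ) ≠ 0 := fun h => hv0 (Subtype.ext h)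
  obtain ⟨m₀, hm₀⟩ := support_nonempty.2 hv0'
  have hcol := fun (m : Fin n × Fin n →₀ ℕ)
      (hm : m ∈ (v : MvPolynomial (Fin n × Fin n) ℂ).support) (b : Fin n) =>
    natCast_colsum_eq_of_mem_weightSpace U.toRepresentation U.toSubmodule.subtype (fun _ _ => rfl)
      (highestWeightSpace_le_weightSpace _ _ hv) hm b
  set χN : Fin n → ℕ := fun b => ∑ a, m₀ (a, b) with hχN
  have hcolN : ∀ m ∈ (v : MvPolynomial (Fin n × Fin n) ℂ).support, ∀ b, ∑ a, m (a, b) = χN b :=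
    fun m hm b => by
      have h := (hcol m hm b).trans (hcol m₀ hm₀ b).symm
      exact_mod_cast h
  have hχs : ∑ b, χN b ≤ s := by
    refine le_trans (le_of_eq ?_) ((le_totalDegree hm₀).trans (hUs v))
    rw [Finsupp.sum_fintype _ _ (fun _ => rfl), Fintype.sum_prod_type, Finset.sum_comm]
  -- the `U⁻`-translates of `v`
  have hle : (lowerSpan U.toRepresentation v).map U.toSubmodule.subtype ≤ Submodule.span ℂ
      (Set.range fun A : Matrix (Fin n) (Fin n) ℂ => matTransl (Fin n) ℂ
        (lowerUnitriMatrix fun p : LowIdx (Fin n) => A p.1.1 p.1.2)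
          (v : MvPolynomial (Fin n × Fin n) ℂ)) := by
    rw [lowerSpan, Submodule.map_span, ← Set.range_comp]
    refine Submodule.span_mono ?_
    rintro _ ⟨c, rfl⟩
    refine ⟨lowerUnitriMatrix c, ?_⟩
    change matTransl (Fin n) ℂ (lowerUnitriMatrix fun p : LowIdx (Fin n) =>
        lowerUnitriMatrix c p.1.1 p.1.2) (v : MvPolynomial (Fin n × Fin n) ℂ) =
      matTransl (Fin n) ℂ ((lowerUnitri c : GL (Fin n) ℂ) : Matrix (Fin n) (Fin n) ℂ)
        (v : MvPolynomial (Fin n × Fin n) ℂ)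
    rw [coe_lowerUnitri, lowerUnitriMatrix_entries_lowerUnitriMatrix]
  haveI : FiniteDimensional ℂ (Submodule.span ℂ (Set.range fun A : Matrix (Fin n) (Fin n) ℂ =>
      matTransl (Fin n) ℂ (lowerUnitriMatrix fun p : LowIdx (Fin n) => A p.1.1 p.1.2)
        (v : MvPolynomial (Fin n × Fin n) ℂ))) := by
    refine Submodule.finiteDimensional_of_le (S₂ := restrictTotalDegree (Fin n × Fin n) ℂ s) ?_
    refine Submodule.span_le.2 ?_
    rintro _ ⟨A, rfl⟩
    rw [SetLike.mem_coe, mem_restrictTotalDegree]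
    exact (totalDegree_matTransl_le _ _).trans (hUs v)
  calc Module.finrank ℂ W.toSubmodule = Module.finrank ℂ U.toSubmodule := eW.finrank_eq
    _ = Module.finrank ℂ (lowerSpan U.toRepresentation v) := by rw [htop, finrank_top]
    _ = Module.finrank ℂ ((lowerSpan U.toRepresentation v).map U.toSubmodule.subtype) :=
        LinearEquiv.finrank_eq (Submodule.equivMapOfInjective _ U.toSubmodule.injective_subtype _)
    _ ≤ _ := Submodule.finrank_mono hle
    _ ≤ s ^ (n * (n - 1) / 2) := finrank_span_lowerTranslates_le hn hs χN hχs _ hcolN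

end Summit.MatrixMultiplication.MatrixMultiplication.Theorems

end
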